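import Summits.QuantumFields.YangMills.Theses.FradkinShenkerFlow
import Literature.Barriers.QuantumFields.ElitzurTheorem
import Literature.MathematicalPhysics.QuantumFieldTheory.ConstructiveQFTWave0Proofs
import Literature.MathematicalPhysics.QuantumFieldTheory.LatticeGaugeProofs

/-!
# Stub `stub_orbitSliceSplit` of the line `orbit-slice-reduction` (crux `SusceptibilityToPoincare`)

Route `FradkinShenkerFlow` of `YangMills`, crux item `stmt-QuantumFields-9441`
(`Summit.QuantumFields.YangMills.Theses.FradkinShenkerFlow.SusceptibilityToPoincare`, FS ⇒ UP).
This file proves part (1) of the transfer `UP_inv ⇒ UP` of the registered skeleton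
`Cruxes/SusceptibilityToPoincare/Lines/orbit-slice-reduction.lean`: the **orbit–slice splitting of
the variance**. For the 4D torus of side `2S+1`, the Wilson measure `μ = wilsonMeasure r.ρ β`, the
product Haar probability measure `π = Haar^{⊗ sites}` of the gauge group and a bounded measurable
`F`, the orbit average `F̄ U = ∫ F(U^g) dπ(g)` is measurable, bounded by the same constant,
gauge invariant, and

  `Var_μ F ≤ Var_μ F̄ + ∫ Var_π(g ↦ F(U^g)) dμ(U)`

(in fact with equality).

## Proof

The splitting is an identity of abstract probability (`variance_orbit_split`): for a probability
space `(Ω, μ)`, a probability space of "symmetries" `(K, π)`, a jointly measurable action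
`act : K → Ω → Ω` leaving every integral against `μ` invariant, and bounded measurable `F`,
* `E_μ F̄ = E_μ F` (Fubini and invariance);
* for every constant `m`, `∫ (F − m)² dμ = ∫∫ (F(act k ω) − m)² dπ dμ` (invariance for each `k`,
  average over `k`, Fubini), and pointwise in `ω` the bias–variance decomposition
  `∫ (X − m)² dπ = Var_π X + (E_π X − m)²` for `X = F(act · ω)`, `E_π X = F̄ ω`
  (`integral_sub_sq_eq_variance_add_sq`);
* with `m = E_μ F = E_μ F̄` this reads `Var_μ F = Var_μ F̄ + ∫ Var_π(F(act · ω)) dμ`.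
The lattice instance: `act g U = gaugeTransform g U` is jointly continuous
(`continuous_gaugeAction_univ`), hence measurable for second-countable `G` (second countability
comes from the faithful representation `r`); `μ` is gauge invariant
(`wilsonMeasure_map_gaugeTransform_holds`, used through the measurable equivalence
`Elitzur.gaugeTransformMEquiv`); gauge invariance of `F̄` is right invariance of `π` on the gauge
group `G^{sites}` together with `U^{g h} = (U^h)^g` (`gaugeTransform_mul`).
-/

noncomputable section

open MeasureTheory ProbabilityTheory
open Literature.MathematicalPhysics.QuantumFieldTheory

namespace Summit.QuantumFields.YangMills.Theorems.SusceptibilityToPoincare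

/-! ### Abstract probability: bias–variance and the orbit splitting of the variance -/

section Abstract

variable {Ω K : Type*} [MeasurableSpace Ω] [MeasurableSpace K]

/-- **Bias–variance decomposition**: for a bounded measurable `X` on a probability space and any
constant `m`, `∫ (X − m)² = Var X + (E X − m)²`. [folklore] -/
theorem integral_sub_sq_eq_variance_add_sq {π : Measure K} [IsProbabilityMeasure π] {X : K → ℝ}
    (hX : Measurable X) {C : ℝ} (hC : ∀ k, |X k| ≤ C) (m : ℝ) :
    ∫ k, (X k - m) ^ 2 ∂π = variance X π + ((∫ k, X k ∂π) - m) ^ 2 := by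
  have hXi : Integrable X π := Integrable.of_bound hX.aestronglyMeasurable C
    (ae_of_all _ fun k => by simpa [Real.norm_eq_abs] using hC k)
  rw [variance_eq_integral hX.aemeasurable]
  set a : ℝ := ∫ k, X k ∂π with ha
  have hb : ∀ k, ‖(X k - a) ^ 2‖ ≤ (|C| + |a|) ^ 2 := fun k => by
    rw [norm_pow, Real.norm_eq_abs]
    have h1 : |X k - a| ≤ |C| + |a| :=
      (abs_sub _ _).trans (add_le_add ((hC k).trans (le_abs_self C)) le_rfl)
    exact pow_le_pow_left₀ (abs_nonneg _) h1 2
  have h2i : Integrable (fun k => (X k - a) ^ 2) π :=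
    Integrable.of_bound ((hX.sub_const a).pow_const 2).aestronglyMeasurable _ (ae_of_all _ hb)
  have hl1 : Integrable (fun k => 2 * (a - m) * (X k - a)) π :=
    (hXi.sub (integrable_const a)).const_mul (2 * (a - m))
  have hlin : Integrable (fun k => 2 * (a - m) * (X k - a) + (a - m) ^ 2) π :=
    hl1.add (integrable_const _)
  calc ∫ k, (X k - m) ^ 2 ∂π
      = ∫ k, ((X k - a) ^ 2 + (2 * (a - m) * (X k - a) + (a - m) ^ 2)) ∂π := by
        refine integral_congr_ae (ae_of_all _ fun k => ?_)
        simp only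
        ring
    _ = ∫ k, (X k - a) ^ 2 ∂π + ∫ k, (2 * (a - m) * (X k - a) + (a - m) ^ 2) ∂π :=
        integral_add h2i hlin
    _ = ∫ k, (X k - a) ^ 2 ∂π + (a - m) ^ 2 := by
        congr 1
        rw [integral_add hl1 (integrable_const _), integral_const_mul,
          integral_sub hXi (integrable_const a), integral_const, integral_const]
        simp [ha]

/-- The orbit average `ω ↦ ∫ F(act k ω) dπ(k)` of a measurable `F` along a jointly measurable
action is measurable (measurability of a parametric Bochner integral). [folklore] -/
theorem measurable_orbitAverage {π : Measure K} [SFinite π] {act : K → Ω → Ω}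
    (hact : Measurable fun p : K × Ω => act p.1 p.2) {F : Ω → ℝ} (hF : Measurable F) :
    Measurable fun ω => ∫ k, F (act k ω) ∂π := by
  have hFj : Measurable fun p : K × Ω => F (act p.1 p.2) := hF.comp hact
  exact (hFj.stronglyMeasurable.integral_prod_left' (μ := π)).measurable

omit [MeasurableSpace Ω] in
/-- The orbit average of a function bounded by `M` is bounded by `M` (probability measure).
[folklore] -/
theorem abs_orbitAverage_le {π : Measure K} [IsProbabilityMeasure π] (act : K → Ω → Ω)
    {F : Ω → ℝ} {M : ℝ} (hM : ∀ ω, |F ω| ≤ M) (ω : Ω) : |∫ k, F (act k ω) ∂π| ≤ M := by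
  have := norm_integral_le_of_norm_le_const (μ := π) (f := fun k => F (act k ω)) (C := M)
    (ae_of_all _ fun k => by simpa [Real.norm_eq_abs] using hM (act k ω))
  simpa [Real.norm_eq_abs, probReal_univ] using this

/-- **Orbit splitting of the variance** (abstract form). Let `(Ω, μ)` and `(K, π)` be probability
spaces, `act : K → Ω → Ω` a jointly measurable action each of whose maps `act k` leaves all
integrals against `μ` invariant, and `F` bounded measurable with orbit average
`F̄ ω = ∫ F(act k ω) dπ(k)`. Then `E_μ F̄ = E_μ F` and
`Var_μ F = Var_μ F̄ + ∫ Var_π(k ↦ F(act k ω)) dμ(ω)`: average the invariant quantity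
`∫ (F∘act k − m)² dμ` over `k`, swap the integrals, and split pointwise by bias–variance.
[folklore] -/
theorem variance_orbit_split {μ : Measure Ω} {π : Measure K} [IsProbabilityMeasure μ]
    [IsProbabilityMeasure π] {act : K → Ω → Ω} (hact : Measurable fun p : K × Ω => act p.1 p.2)
    (hinv : ∀ (k : K) (f : Ω → ℝ), ∫ ω, f (act k ω) ∂μ = ∫ ω, f ω ∂μ)
    {F : Ω → ℝ} (hF : Measurable F) {M : ℝ} (hM : ∀ ω, |F ω| ≤ M) :
    ∫ ω, (∫ k, F (act k ω) ∂π) ∂μ = ∫ ω, F ω ∂μ ∧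
    variance F μ = variance (fun ω => ∫ k, F (act k ω) ∂π) μ +
      ∫ ω, variance (fun k => F (act k ω)) π ∂μ := by
  have hFj : Measurable fun p : K × Ω => F (act p.1 p.2) := hF.comp hact
  have hXm : ∀ ω, Measurable fun k => F (act k ω) := fun ω => hFj.comp measurable_prodMk_right
  have hAm : Measurable fun ω => ∫ k, F (act k ω) ∂π := measurable_orbitAverage hact hF
  have hbF : ∀ k ω, ‖F (act k ω)‖ ≤ |M| := fun k ω => by
    rw [Real.norm_eq_abs]; exact (hM _).trans (le_abs_self M)
  have hAb : ∀ ω, |∫ k, F (act k ω) ∂π| ≤ |M| := fun ω =>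
    abs_orbitAverage_le act (fun ω => (hM ω).trans (le_abs_self M)) ω
  -- the mean of the orbit average
  have hmean : ∫ ω, (∫ k, F (act k ω) ∂π) ∂μ = ∫ ω, F ω ∂μ := by
    have hint : Integrable (Function.uncurry fun ω k => F (act k ω)) (μ.prod π) :=
      Integrable.of_bound (hFj.comp measurable_swap).aestronglyMeasurable |M|
        (ae_of_all _ fun p => hbF p.2 p.1)
    have h1 : ∀ k, ∫ ω, F (act k ω) ∂μ = ∫ ω, F ω ∂μ := fun k => hinv k F
    rw [integral_integral_swap hint]
    simp only [h1, integral_const, probReal_univ, one_smul]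
  -- the splitting, for every centring constant `m`
  have key : ∀ m : ℝ, ∫ ω, (F ω - m) ^ 2 ∂μ =
      ∫ ω, ((∫ k, F (act k ω) ∂π) - m) ^ 2 ∂μ + ∫ ω, variance (fun k => F (act k ω)) π ∂μ := by
    intro m
    have h1 : ∀ k, ∫ ω, (F (act k ω) - m) ^ 2 ∂μ = ∫ ω, (F ω - m) ^ 2 ∂μ := fun k =>
      hinv k fun ω => (F ω - m) ^ 2
    have hsq : ∀ x : ℝ, |x| ≤ |M| → ‖(x - m) ^ 2‖ ≤ (|M| + |m|) ^ 2 := fun x hx => by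
      rw [norm_pow, Real.norm_eq_abs]
      exact pow_le_pow_left₀ (abs_nonneg _) ((abs_sub _ _).trans (add_le_add hx le_rfl)) 2
    have hb2 : ∀ k ω, ‖(F (act k ω) - m) ^ 2‖ ≤ (|M| + |m|) ^ 2 := fun k ω =>
      hsq _ ((hM _).trans (le_abs_self M))
    have hint2 : Integrable (Function.uncurry fun k ω => (F (act k ω) - m) ^ 2) (π.prod μ) :=
      Integrable.of_bound ((hFj.sub_const m).pow_const 2).aestronglyMeasurable _
        (ae_of_all _ fun p => hb2 p.1 p.2)
    have hswap : ∫ ω, (F ω - m) ^ 2 ∂μ = ∫ ω, ∫ k, (F (act k ω) - m) ^ 2 ∂π ∂μ := by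
      rw [← integral_integral_swap hint2]
      simp only [h1, integral_const, probReal_univ, one_smul]
    have hpt : ∀ ω, ∫ k, (F (act k ω) - m) ^ 2 ∂π =
        variance (fun k => F (act k ω)) π + ((∫ k, F (act k ω) ∂π) - m) ^ 2 := fun ω =>
      integral_sub_sq_eq_variance_add_sq (hXm ω) (fun k => hM (act k ω)) m
    -- integrability of the two summands in `ω`
    have hΦm : Measurable fun ω => ∫ k, (F (act k ω) - m) ^ 2 ∂π :=
      (((hFj.sub_const m).pow_const 2).stronglyMeasurable.integral_prod_left' (μ := π)).measurable
    have hΦi : Integrable (fun ω => ∫ k, (F (act k ω) - m) ^ 2 ∂π) μ :=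
      Integrable.of_bound hΦm.aestronglyMeasurable ((|M| + |m|) ^ 2) (ae_of_all _ fun ω => by
        have := norm_integral_le_of_norm_le_const (μ := π) (ae_of_all _ fun k => hb2 k ω)
        simpa [probReal_univ] using this)
    have hA2i : Integrable (fun ω => ((∫ k, F (act k ω) ∂π) - m) ^ 2) μ :=
      Integrable.of_bound ((hAm.sub_const m).pow_const 2).aestronglyMeasurable ((|M| + |m|) ^ 2)
        (ae_of_all _ fun ω => hsq _ (hAb ω))
    have hVeq : (fun ω => variance (fun k => F (act k ω)) π) =
        fun ω => ∫ k, (F (act k ω) - m) ^ 2 ∂π - ((∫ k, F (act k ω) ∂π) - m) ^ 2 := by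
      funext ω
      rw [hpt ω]
      ring
    have hVi : Integrable (fun ω => variance (fun k => F (act k ω)) π) μ := by
      rw [hVeq]
      exact hΦi.sub hA2i
    rw [hswap]
    simp_rw [hpt]
    rw [integral_add hVi hA2i, add_comm]
  refine ⟨hmean, ?_⟩
  have hVarA : variance (fun ω => ∫ k, F (act k ω) ∂π) μ =
      ∫ ω, ((∫ k, F (act k ω) ∂π) - ∫ ω, F ω ∂μ) ^ 2 ∂μ := by
    rw [variance_eq_integral hAm.aemeasurable, hmean]
  rw [variance_eq_integral hF.aemeasurable, hVarA]
  exact key _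

end Abstract

/-! ### The lattice instance: gauge transformations of the torus -/

section Lattice

variable {d L : ℕ} {G : Type*} [Group G]

/-- Composition of gauge transformations: `U^{g h} = (U^h)^g` for the pointwise product `g h` of
`g, h : Λ → G`. [folklore] -/
theorem gaugeTransform_mul (g h : Site d L → G) (U : GaugeConfig d L G) :
    gaugeTransform (g * h) U = gaugeTransform g (gaugeTransform h U) := by
  funext e
  simp [gaugeTransform, mul_assoc]

variable [TopologicalSpace G] [IsTopologicalGroup G]

/-- **Joint continuity of the full gauge action** `(g, U) ↦ U^g` on `G^Λ × G^E` (each link is a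
product of coordinate projections and an inverse). [folklore] -/
theorem continuous_gaugeAction_univ :
    Continuous fun p : (Site d L → G) × GaugeConfig d L G => gaugeTransform p.1 p.2 := by
  refine continuous_pi fun e => ?_
  simp only [gaugeTransform]
  exact ((((continuous_apply e.1).comp continuous_fst).mul
    ((continuous_apply e).comp continuous_snd)).mul
      ((continuous_apply (e.1.shift e.2)).comp continuous_fst).inv)

variable [CompactSpace G] [MeasurableSpace G] [BorelSpace G]

/-- **The orbit average is gauge invariant**: `F̄(U^h) = ∫ F((U^h)^g) dπ(g) = ∫ F(U^{g h}) dπ(g)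
= F̄(U)` by right invariance of the product Haar probability measure `π` on the gauge group
`G^Λ` (compact groups are unimodular). No measurability of `F` is needed. [folklore] -/
theorem isGaugeInvariant_orbitAverage [NeZero L] (F : GaugeConfig d L G → ℝ) :
    IsGaugeInvariant (fun U : GaugeConfig d L G =>
      ∫ g, F (gaugeTransform g U) ∂(Measure.pi fun _ : Site d L => haarProbability G)) := by
  intro h U
  simp only [← gaugeTransform_mul]
  exact integral_mul_right_eq_self (μ := Measure.pi fun _ : Site d L => haarProbability G)
    (fun g => F (gaugeTransform g U)) h

/-- **Change of variables along a gauge transformation in the Wilson measure**: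
`∫ f(U^γ) dμ = ∫ f dμ` for `μ = wilsonMeasure ρ β` and *every* `f` — the gauge transformation is a
measurable equivalence (`Elitzur.gaugeTransformMEquiv`) preserving `μ`
(`wilsonMeasure_map_gaugeTransform_holds`). [folklore] -/
theorem integral_comp_gaugeTransform_wilsonMeasure [NeZero L] {N : ℕ}
    (ρ : G →* Matrix (Fin N) (Fin N) ℂ) (β : ℝ) (γ : Site d L → G) (f : GaugeConfig d L G → ℝ) :
    ∫ U, f (gaugeTransform γ U) ∂(wilsonMeasure ρ β) =
      ∫ U, f U ∂(wilsonMeasure (d := d) (L := L) ρ β) := by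
  have h : MeasurePreserving
      (Literature.Barriers.QuantumFields.Elitzur.gaugeTransformMEquiv (d := d) (L := L) (G := G) γ)
      (wilsonMeasure (d := d) (L := L) ρ β) (wilsonMeasure (d := d) (L := L) ρ β) :=
    ⟨(Literature.Barriers.QuantumFields.Elitzur.measurePreserving_gaugeTransform γ).measurable,
      wilsonMeasure_map_gaugeTransform_holds (d := d) (L := L) ρ β γ⟩
  exact h.integral_comp' f

end Lattice

/-! ### The registered stub -/

/-- `stub_orbitSliceSplit` — **orbit–slice splitting of the variance** (part (1) of the transfer
`UP_inv ⇒ UP` of the line `orbit-slice-reduction`). For every compact group `G` with a lattice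
representation `r`, every real `β`, every side `2S+1` and every measurable `F` with `|F| ≤ M` on
the configurations of the 4D torus, the orbit average `F̄ U = ∫ F(U^g) dπ(g)` over the product
Haar probability measure `π = Haar^{⊗ sites}` is measurable, bounded by `M`, gauge invariant, and
`Var_μ F ≤ Var_μ F̄ + ∫ Var_π(g ↦ F(U^g)) dμ(U)` for the Wilson measure `μ = wilsonMeasure r.ρ β`
(with equality, `variance_orbit_split`). [folklore] -/
theorem stub_orbitSliceSplit :
    ∀ (G : Type) [Group G] [TopologicalSpace G] [IsTopologicalGroup G] [CompactSpace G]
      [MeasurableSpace G] [BorelSpace G] (r : LatticeRep G) (β : ℝ) (S : ℕ)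
      (F : GaugeConfig 4 (2 * S + 1) G → ℝ), Measurable F → ∀ M : ℝ, (∀ U, |F U| ≤ M) →
      Measurable (fun U : GaugeConfig 4 (2 * S + 1) G =>
          ∫ g, F (gaugeTransform g U) ∂(Measure.pi fun _ : Site 4 (2 * S + 1) => haarProbability G)) ∧
      (∀ U : GaugeConfig 4 (2 * S + 1) G,
          |∫ g, F (gaugeTransform g U) ∂(Measure.pi fun _ : Site 4 (2 * S + 1) => haarProbability G)| ≤ M) ∧
      IsGaugeInvariant (fun U : GaugeConfig 4 (2 * S + 1) G =>
          ∫ g, F (gaugeTransform g U) ∂(Measure.pi fun _ : Site 4 (2 * S + 1) => haarProbability G)) ∧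
      variance F (wilsonMeasure (d := 4) (L := 2 * S + 1) r.ρ β) ≤
        variance (fun U : GaugeConfig 4 (2 * S + 1) G =>
            ∫ g, F (gaugeTransform g U) ∂(Measure.pi fun _ : Site 4 (2 * S + 1) => haarProbability G))
          (wilsonMeasure (d := 4) (L := 2 * S + 1) r.ρ β) +
        ∫ U, variance (fun g : Site 4 (2 * S + 1) → G => F (gaugeTransform g U))
            (Measure.pi fun _ : Site 4 (2 * S + 1) => haarProbability G)
          ∂(wilsonMeasure (d := 4) (L := 2 * S + 1) r.ρ β) := by
  intro G _ _ _ _ _ _ r β S F hF M hM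
  haveI : SecondCountableTopology G :=
    (r.continuous.isClosedEmbedding r.injective).isEmbedding.secondCountableTopology
  haveI : IsProbabilityMeasure (wilsonMeasure (d := 4) (L := 2 * S + 1) r.ρ β) :=
    isProbabilityMeasure_wilsonMeasure (d := 4) (L := 2 * S + 1) r.ρ r.continuous β
  have hact : Measurable fun p : (Site 4 (2 * S + 1) → G) × GaugeConfig 4 (2 * S + 1) G =>
      gaugeTransform p.1 p.2 :=
    (continuous_gaugeAction_univ (d := 4) (L := 2 * S + 1) (G := G)).measurable
  have hinv : ∀ (g : Site 4 (2 * S + 1) → G) (f : GaugeConfig 4 (2 * S + 1) G → ℝ),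
      ∫ U, f (gaugeTransform g U) ∂(wilsonMeasure (d := 4) (L := 2 * S + 1) r.ρ β) =
        ∫ U, f U ∂(wilsonMeasure (d := 4) (L := 2 * S + 1) r.ρ β) := fun g f =>
    integral_comp_gaugeTransform_wilsonMeasure r.ρ β g f
  obtain ⟨-, hsplit⟩ := variance_orbit_split
    (π := Measure.pi fun _ : Site 4 (2 * S + 1) => haarProbability G) hact hinv hF hM
  exact ⟨measurable_orbitAverage hact hF, abs_orbitAverage_le _ hM,
    isGaugeInvariant_orbitAverage F, le_of_eq hsplit⟩

end Summit.QuantumFields.YangMills.Theorems.SusceptibilityToPoincare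

end
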